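/-
Copyright (c) 2026. All rights reserved.
Released under Apache 2.0 license as described in the file LICENSE.
Authors: abc-iut cell, seat abc-iut-w5-d053 (gen 4; row «COR37-LOGOBS-GLUE», part (b) of abc-iut-L4-t5's
«COR37-COMPAT-LITERAL» split — the homotopies of the glued family).
-/
import Literature.AnabelianGeometry.AbsoluteAnabelian.AbsTopIII.BiAnabelianLogGlueDec
import Literature.AnabelianGeometry.AbsoluteAnabelian.AbsTopIII.BiAnabelianCompatibilityCrossCellsLog
import Literature.AnabelianGeometry.AbsoluteAnabelian.StrictHomotopyFamilies
import HarnessLib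

/-!
# [AbsTopIII] Cor 3.7 (iii), second clause — the HOMOTOPIES of the family on `𝒟*` gluing the cores with
# the observable `𝔖†_log`: presentations of glued pairs and well-definedness

S. Mochizuki, *Topics in absolute anabelian geometry III* [MochizukiAbsTopIII2015] (kurims manuscript
`paper:url-5493eb38cbb7`), Cor 3.7 (iii) p. 88 (the family of `𝔖†_log` "is compatible with the families of
homotopies that constitute the core and telecore structures of (i), (ii)"), Def 3.5 (ii) p. 75, proof of
Cor 3.6 (iii) p. 81 ("`ι_{log,⋎}` (respectively, `ι_×`) determine(s) the homotopies for pairs of type (1)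
(respectively, (2))").

Continuation of `BiAnabelianLogGlue.lean` / `…Saturated.lean` / `…Dec.lean` (the boundary set `GlueE` on
`Γ⃗_{𝒟*}`, its saturation, presentations `GlueDec` of glued pairs).  Over a setting `𝔖` (abc-iut-L4-t9's
`BiAnabelianSetting`, diagram `𝒟* = 𝔖.starDiagram`) this file attaches the HOMOTOPY to a glued pair
`(P, R) ∈ GlueE`, between the structural path functors `𝒟*_[P] ⟶ 𝒟*_[R]` (abc-iut-L4-t12's `pathFunctor'`):
* pairs into `𝔈`: the homotopy of abc-iut-L4-t5's universal family `K₀ = coresFamily` over `𝔈` (p445994);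
* other pairs, through a PRESENTATION (`StarGlue.GlueDec` of `BiAnabelianLogGlueDec.lean`): the identity
  (`eqToHom`) on `P = R` and on pairs re-routed through the reference model `𝒳` (equal functors,
  abc-iut-L4-t5's `pathFunctor_eq_of_target_ref`), the cell homotopy `cellη` (`𝟙`, `ι_×`, `ι_{log,⋎}` behind
  the prefix) on cell pairs, and `eqToHom ≫ (𝒟*_[q] ◁ cellη g)` on «𝒳-pair THEN cell» pairs;
* `GlueDec.val_heq` — two presentations of the same pair give the same homotopy (unique split at the last visit
  to `ref`, a cell is determined by its two sides `StarCell.ext'`, reflexive cells act by identities) — whence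
  the homotopy `glueLogη` of a pair and its computation rules `glueLogη_of_galois` / `glueLogη_eq_val`.
The family laws and the closer `logObsCompatCoresStmt_of_iotaOverGal` follow in `BiAnabelianLogGlueLaws.lean` /
`BiAnabelianLogGlueFamily.lean`.

HONEST FRAMING: bookkeeping over the cell's typing of refereed pre-IUT material; definitions and
well-definedness only, no `Prop` fact, no instance; nothing here bears on [IUTchIII] Cor. 3.12.
-/

set_option autoImplicit false

namespace Literature.AnabelianGeometry.AbsoluteAnabelian.AbsTopIII

open CategoryTheory Quiver
open Literature.AnabelianGeometry.AbsoluteAnabelian.DiagramOfCategories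

universe u

/-! ## The homotopies -/

namespace BiAnabelianSetting

open StarGlue

variable {X E N : Type u} [Category.{u} X] [Category.{u} E] [Category.{u} N]
  (𝔖 : BiAnabelianSetting X E N)

/-! ### Generic `eqToHom` / `HEq` bookkeeping -/

section HEqKit

variable {A : Type*} [Category A] {B : Type*} [Category B] {C : Type*} [Category C]

/-- Left whiskering respects heterogeneous equality (bookkeeping for Def. 3.5 (ii) families).
[cite: MochizukiAbsTopIII2015, Definition 3.5 (ii) p.75] -/
theorem whiskerLeft_heq {R R' : A ⥤ B} (hR : R = R') {F G F' G' : B ⥤ C} (hF : F = F') (hG : G = G')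
    {α : F ⟶ G} {α' : F' ⟶ G'} (h : HEq α α') :
    HEq (Functor.whiskerLeft R α) (Functor.whiskerLeft R' α') := by
  subst hR hF hG; cases h; rfl

/-- Right whiskering respects heterogeneous equality (bookkeeping for Def. 3.5 (ii) families).
[cite: MochizukiAbsTopIII2015, Definition 3.5 (ii) p.75] -/
theorem whiskerRight_heq {F G F' G' : A ⥤ B} (hF : F = F') (hG : G = G') {α : F ⟶ G} {α' : F' ⟶ G'}
    (h : HEq α α') {T T' : B ⥤ C} (hT : T = T') :
    HEq (Functor.whiskerRight α T) (Functor.whiskerRight α' T') := by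
  subst hF hG hT; cases h; rfl

/-- Composition respects heterogeneous equality (bookkeeping for Def. 3.5 (ii) families).
[cite: MochizukiAbsTopIII2015, Definition 3.5 (ii) p.75] -/
theorem comp_heq {a b c a' b' c' : A} (ha : a = a') (hb : b = b') (hc : c = c') {f : a ⟶ b} {g : b ⟶ c}
    {f' : a' ⟶ b'} {g' : b' ⟶ c'} (hf : HEq f f') (hg : HEq g g') : HEq (f ≫ g) (f' ≫ g') := by
  subst ha hb hc; cases hf; cases hg; rfl

/-- Identities of equal objects are heterogeneously equal (bookkeeping for Def. 3.5 (ii) families).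
[cite: MochizukiAbsTopIII2015, Definition 3.5 (ii) p.75] -/
theorem id_heq_id {a a' : A} (h : a = a') : HEq (𝟙 a) (𝟙 a') := by subst h; rfl

/-- An `eqToHom` is heterogeneously an identity (bookkeeping for Def. 3.5 (ii) families).
[cite: MochizukiAbsTopIII2015, Definition 3.5 (ii) p.75] -/
theorem eqToHom_heq_id {a b c : A} (h : a = b) (hc : a = c) : HEq (eqToHom h) (𝟙 c) := by
  subst h hc; rfl

/-- Two `eqToHom`s between respectively equal objects are heterogeneously equal (bookkeeping for Def. 3.5 (ii) families).
[cite: MochizukiAbsTopIII2015, Definition 3.5 (ii) p.75] -/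
theorem eqToHom_heq_eqToHom {a b a' b' : A} (h : a = b) (h' : a' = b') (ha : a = a') :
    HEq (eqToHom h) (eqToHom h') := by
  subst h h' ha; rfl

/-- A morphism pre-composed with an `eqToHom` is heterogeneously itself (bookkeeping for Def. 3.5 (ii) families).
[cite: MochizukiAbsTopIII2015, Definition 3.5 (ii) p.75] -/
theorem eqToHom_comp_heq {a a' b : A} (h : a = a') (f : a' ⟶ b) : HEq (eqToHom h ≫ f) f := by
  subst h; simp

/-- A morphism post-composed with an `eqToHom` is heterogeneously itself (bookkeeping for Def. 3.5 (ii) families).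
[cite: MochizukiAbsTopIII2015, Definition 3.5 (ii) p.75] -/
theorem comp_eqToHom_heq {a b b' : A} (f : a ⟶ b) (h : b = b') : HEq (f ≫ eqToHom h) f := by
  subst h; simp

/-- Left whiskering an `eqToHom` (bookkeeping for Def. 3.5 (ii) families).
[cite: MochizukiAbsTopIII2015, Definition 3.5 (ii) p.75] -/
theorem whiskerLeft_eqToHom (R : A ⥤ B) {F G : B ⥤ C} (h : F = G) :
    Functor.whiskerLeft R (eqToHom h) = eqToHom (by rw [h]) := by
  subst h; simp

/-- Right whiskering an `eqToHom` (bookkeeping for Def. 3.5 (ii) families).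
[cite: MochizukiAbsTopIII2015, Definition 3.5 (ii) p.75] -/
theorem eqToHom_whiskerRight {F G : A ⥤ B} (h : F = G) (T : B ⥤ C) :
    Functor.whiskerRight (eqToHom h) T = eqToHom (by rw [h]) := by
  subst h; simp

/-- Iterated left whiskering is left whiskering by the composite (on the nose) (bookkeeping for Def. 3.5 (ii) families).
[cite: MochizukiAbsTopIII2015, Definition 3.5 (ii) p.75] -/
theorem whiskerLeft_whiskerLeft {D : Type*} [Category D] (R : A ⥤ B) (S : B ⥤ C) {F G : C ⥤ D}
    (α : F ⟶ G) : Functor.whiskerLeft R (Functor.whiskerLeft S α) = Functor.whiskerLeft (R ⋙ S) α :=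
  NatTrans.ext (funext fun _ => rfl)

/-- `(R ◁ α) ▷ T = R ◁ (α ▷ T)` on the nose (bookkeeping for Def. 3.5 (ii) families).
[cite: MochizukiAbsTopIII2015, Definition 3.5 (ii) p.75] -/
theorem whiskerRight_whiskerLeft {D : Type*} [Category D] (R : A ⥤ B) {F G : B ⥤ C} (α : F ⟶ G)
    (T : C ⥤ D) : Functor.whiskerRight (Functor.whiskerLeft R α) T =
      Functor.whiskerLeft R (Functor.whiskerRight α T) :=
  NatTrans.ext (funext fun _ => rfl)

/-- Right whiskering by the identity functor does nothing, heterogeneously (bookkeeping for Def. 3.5 (ii) families).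
[cite: MochizukiAbsTopIII2015, Definition 3.5 (ii) p.75] -/
theorem whiskerRight_id_heq {F G : A ⥤ B} (α : F ⟶ G) : HEq (Functor.whiskerRight α (𝟭 B)) α := by
  have : Functor.whiskerRight α (𝟭 B) = α := NatTrans.ext (funext fun _ => rfl)
  exact heq_of_eq this

end HEqKit

/-! ### The cell homotopy -/

/-- **The homotopy of a cell** `g` between the structural path functors of its sides: the identity (type (3)),
`𝒟*_[r] ◁ ι_×` (type (2)), `𝒟*_[r] ◁ ι_{log,⋎}` (type (1), `ι_{log,⋎} = pr ◁ ι_log`).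
[cite: MochizukiAbsTopIII2015, Cor 3.7 (iii) p.88] -/
def cellη {x : Cor37Vertex} : ∀ g : StarCell.{u} x,
    (𝔖.starDiagram.pathFunctor' g.left ⟶ 𝔖.starDiagram.pathFunctor' g.right)
  | .refl _ _ => 𝟙 _
  | .times r => Functor.whiskerLeft (𝔖.starDiagram.pathFunctor' r) 𝔖.iotaTimes
  | .log _ r => Functor.whiskerLeft (𝔖.starDiagram.pathFunctor' r) 𝔖.iotaLogAt

/-- The homotopy of a reflexive cell is the identity (`eqToHom`). [cite: MochizukiAbsTopIII2015, Cor 3.7 (iii) p.88] -/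
theorem cellη_of_eq {x : Cor37Vertex} (g : StarCell.{u} x) (e : g.left = g.right)
    (H : 𝔖.starDiagram.pathFunctor' g.left = 𝔖.starDiagram.pathFunctor' g.right) : 𝔖.cellη g = eqToHom H := by
  cases g with
  | refl r f => rfl
  | times r => exact absurd (eq_of_heq (Path.hom_heq_of_cons_eq_cons e)) (fun h => by cases h)
  | log n r => exact absurd (eq_of_heq (Path.hom_heq_of_cons_eq_cons e)) (fun h => by cases h)

/-- The homotopy of a prefixed cell is the whiskered homotopy (heterogeneously).
[cite: MochizukiAbsTopIII2015, Cor 3.7 (iii) p.88] -/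
theorem cellη_precomp_heq {c x : Cor37Vertex} (r₀ : StarPath.{u} c x) (g : StarCell.{u} x) :
    HEq (𝔖.cellη (g.precomp r₀)) (Functor.whiskerLeft (𝔖.starDiagram.pathFunctor' r₀) (𝔖.cellη g)) := by
  cases g with
  | refl r f =>
    show HEq (𝟙 _) (Functor.whiskerLeft _ (𝟙 _))
    rw [Functor.whiskerLeft_id']
    exact id_heq_id (by rw [← pathFunctor'_comp]; rfl)
  | times r =>
    exact (whiskerLeft_heq (C := N) (pathFunctor'_comp _ r₀ r) rfl rfl
      (HEq.refl 𝔖.iotaTimes)).trans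
      (heq_of_eq (whiskerLeft_whiskerLeft _ _ _).symm)
  | log n r =>
    exact (whiskerLeft_heq (C := N) (pathFunctor'_comp _ r₀ r) rfl rfl
      (HEq.refl 𝔖.iotaLogAt)).trans
      (heq_of_eq (whiskerLeft_whiskerLeft _ _ _).symm)

/-! ### The homotopy of a presentation -/

/-- Structural path functors of paths re-routed through `ref` agree.
[cite: MochizukiAbsTopIII2015, Cor 3.7 (i) p.87] -/
theorem pathFunctor'_reroute {a b : Cor37Vertex} (p q : StarPath.{u} a Cor37Vertex.ref)
    (s : StarPath.{u} Cor37Vertex.ref b) :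
    𝔖.starDiagram.pathFunctor' (p.comp s) = 𝔖.starDiagram.pathFunctor' (q.comp s) := by
  rw [← pathFunctor_eq_pathFunctor', ← pathFunctor_eq_pathFunctor', 𝔖.pathFunctor_comp_eq_of_through_ref p q s]

/-- Structural path functors of co-verticial paths into `ref` agree.
[cite: MochizukiAbsTopIII2015, Cor 3.7 (i) p.87] -/
theorem pathFunctor'_eq_of_target_ref {a : Cor37Vertex} (p q : StarPath.{u} a Cor37Vertex.ref) :
    𝔖.starDiagram.pathFunctor' p = 𝔖.starDiagram.pathFunctor' q :=
  𝔖.pathFunctor'_reroute p q Path.nil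

/-- The «𝒳-pair THEN cell» homotopy: identity re-routing `𝒟*_[p·g.left] = 𝒟*_[q] ⋙ 𝒟*_[g.left]`, then
`𝒟*_[q] ◁ cellη g`. [cite: MochizukiAbsTopIII2015, Cor 3.7 (iii) p.88] -/
def tailVal {a : Cor37Vertex} (p q : StarPath.{u} a Cor37Vertex.ref) (g : StarCell.{u} Cor37Vertex.ref) :
    𝔖.starDiagram.pathFunctor' (p.comp g.left) ⟶ 𝔖.starDiagram.pathFunctor' (q.comp g.right) :=
  eqToHom (by rw [𝔖.pathFunctor'_reroute p q, pathFunctor'_comp]) ≫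
    Functor.whiskerLeft (𝔖.starDiagram.pathFunctor' q) (𝔖.cellη g) ≫
    eqToHom (by rw [pathFunctor'_comp])

/-- `tailVal` is heterogeneously the whiskered cell homotopy. [cite: MochizukiAbsTopIII2015, Cor 3.7 (iii) p.88] -/
theorem tailVal_heq {a : Cor37Vertex} (p q : StarPath.{u} a Cor37Vertex.ref) (g : StarCell.{u} Cor37Vertex.ref) :
    HEq (𝔖.tailVal p q g) (Functor.whiskerLeft (𝔖.starDiagram.pathFunctor' q) (𝔖.cellη g)) :=
  HomotopyFamily.heq_eqToHom_comp_comp_eqToHom _ _ _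

/-- **The homotopy of a presentation.** [cite: MochizukiAbsTopIII2015, Cor 3.7 (iii) p.88] -/
def _root_.Literature.AnabelianGeometry.AbsoluteAnabelian.AbsTopIII.StarGlue.GlueDec.val
    {a b : Cor37Vertex} {P Q : StarPath.{u} a b} :
    GlueDec P Q → (𝔖.starDiagram.pathFunctor' P ⟶ 𝔖.starDiagram.pathFunctor' Q)
  | .rfl h => eqToHom (by rw [h])
  | .reroute p q t _ hP hQ => eqToHom (by rw [hP, hQ, 𝔖.pathFunctor'_reroute p q t])
  | .cell g _ hP hQ => eqToHom (by rw [hP]) ≫ 𝔖.cellη g ≫ eqToHom (by rw [hQ])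
  | .tailCell p q g _ hP hQ => eqToHom (by rw [hP]) ≫ 𝔖.tailVal p q g ≫ eqToHom (by rw [hQ])

/-- The homotopy of a reflexive presentation (an `eqToHom`). [cite: MochizukiAbsTopIII2015, Cor 3.7 (iii) p.88] -/
theorem val_rfl {a b : Cor37Vertex} {P Q : StarPath.{u} a b} (h : P = Q) :
    (GlueDec.rfl h).val 𝔖 = eqToHom (by rw [h]) := rfl

/-- The homotopy of a re-routing presentation (an `eqToHom`). [cite: MochizukiAbsTopIII2015, Cor 3.7 (iii) p.88] -/
theorem val_reroute {a b : Cor37Vertex} {P Q : StarPath.{u} a b} (p q : StarPath.{u} a Cor37Vertex.ref)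
    (t : StarPath.{u} Cor37Vertex.ref b) (ht : refCount t = 0) (hP : P = p.comp t) (hQ : Q = q.comp t) :
    (GlueDec.reroute p q t ht hP hQ).val 𝔖 = eqToHom (by rw [hP, hQ, 𝔖.pathFunctor'_reroute p q t]) := rfl

/-- The homotopy of a cell presentation (unfolded). [cite: MochizukiAbsTopIII2015, Cor 3.7 (iii) p.88] -/
theorem val_cell {a : Cor37Vertex} {P Q : StarPath.{u} a Cor37Vertex.space} (g : StarCell.{u} a)
    (hg : ¬ VisitsRef g.left) (hP : P = g.left) (hQ : Q = g.right) :
    (GlueDec.cell g hg hP hQ).val 𝔖 = eqToHom (by rw [hP]) ≫ 𝔖.cellη g ≫ eqToHom (by rw [hQ]) := rfl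

/-- The homotopy of an «𝒳-pair THEN cell» presentation (unfolded). [cite: MochizukiAbsTopIII2015, Cor 3.7 (iii) p.88] -/
theorem val_tailCell {a : Cor37Vertex} {P Q : StarPath.{u} a Cor37Vertex.space}
    (p q : StarPath.{u} a Cor37Vertex.ref) (g : StarCell.{u} Cor37Vertex.ref) (hg : refCount g.left = 0)
    (hP : P = p.comp g.left) (hQ : Q = q.comp g.right) :
    (GlueDec.tailCell p q g hg hP hQ).val 𝔖 = eqToHom (by rw [hP]) ≫ 𝔖.tailVal p q g ≫ eqToHom (by rw [hQ]) :=
  rfl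

/-- The homotopy of a cell presentation is heterogeneously the cell homotopy.
[cite: MochizukiAbsTopIII2015, Cor 3.7 (iii) p.88] -/
theorem val_cell_heq {a : Cor37Vertex} {P Q : StarPath.{u} a Cor37Vertex.space} (g : StarCell.{u} a)
    (hg : ¬ VisitsRef g.left) (hP : P = g.left) (hQ : Q = g.right) :
    HEq ((GlueDec.cell g hg hP hQ).val 𝔖) (𝔖.cellη g) := by
  subst hP hQ; exact HomotopyFamily.heq_eqToHom_comp_comp_eqToHom _ _ _

/-- The homotopy of an «𝒳-pair THEN cell» presentation is heterogeneously the whiskered cell homotopy.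
[cite: MochizukiAbsTopIII2015, Cor 3.7 (iii) p.88] -/
theorem val_tailCell_heq {a : Cor37Vertex} {P Q : StarPath.{u} a Cor37Vertex.space}
    (p q : StarPath.{u} a Cor37Vertex.ref) (g : StarCell.{u} Cor37Vertex.ref) (hg : refCount g.left = 0)
    (hP : P = p.comp g.left) (hQ : Q = q.comp g.right) :
    HEq ((GlueDec.tailCell p q g hg hP hQ).val 𝔖)
      (Functor.whiskerLeft (𝔖.starDiagram.pathFunctor' q) (𝔖.cellη g)) := by
  subst hP hQ
  exact (HomotopyFamily.heq_eqToHom_comp_comp_eqToHom _ _ _).trans (𝔖.tailVal_heq p q g)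

/-- The homotopy of an «𝒳-pair THEN cell» presentation with a REFLEXIVE cell is an identity.
[cite: MochizukiAbsTopIII2015, Cor 3.7 (iii) p.88] -/
theorem val_tailCell_heq_id {a : Cor37Vertex} {P Q : StarPath.{u} a Cor37Vertex.space}
    (p q : StarPath.{u} a Cor37Vertex.ref) (g : StarCell.{u} Cor37Vertex.ref) (hg : refCount g.left = 0)
    (hP : P = p.comp g.left) (hQ : Q = q.comp g.right) (e : g.left = g.right) :
    HEq ((GlueDec.tailCell p q g hg hP hQ).val 𝔖) (𝟙 (𝔖.starDiagram.pathFunctor' P)) := by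
  refine (𝔖.val_tailCell_heq p q g hg hP hQ).trans ?_
  rw [𝔖.cellη_of_eq g e (by rw [e]), whiskerLeft_eqToHom]
  exact eqToHom_heq_id _ (by rw [hP, 𝔖.pathFunctor'_reroute p q, pathFunctor'_comp])

/-- The homotopy of an «𝒳-pair THEN cell» presentation with a reflexive cell is THE `eqToHom`.
[cite: MochizukiAbsTopIII2015, Cor 3.7 (iii) p.88] -/
theorem val_tailCell_eq_eqToHom {a : Cor37Vertex} {P Q : StarPath.{u} a Cor37Vertex.space}
    (p q : StarPath.{u} a Cor37Vertex.ref) (g : StarCell.{u} Cor37Vertex.ref) (hg : refCount g.left = 0)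
    (hP : P = p.comp g.left) (hQ : Q = q.comp g.right) (e : g.left = g.right)
    (H : 𝔖.starDiagram.pathFunctor' P = 𝔖.starDiagram.pathFunctor' Q) :
    (GlueDec.tailCell p q g hg hP hQ).val 𝔖 = eqToHom H :=
  eq_of_heq ((𝔖.val_tailCell_heq_id p q g hg hP hQ e).trans (eqToHom_heq_id H rfl).symm)

/-- **Well-definedness: two presentations of the same glued pair carry the same homotopy.**  Re-routings and
reflexive presentations are identities; a pair presented both as a re-routing and through a cell has a
reflexive cell (unique split at the last visit to `ref`, `split_unique`); two cell presentations have the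
same cell (`StarCell.ext'`); the cell class and the tail classes do not meet (`VisitsRef`).
[cite: MochizukiAbsTopIII2015, Cor 3.7 (iii) p.88] -/
theorem val_heq {a b : Cor37Vertex} {P Q : StarPath.{u} a b} (d₁ d₂ : GlueDec P Q) :
    d₁.val 𝔖 = d₂.val 𝔖 := by
  apply eq_of_heq
  cases d₁ with
  | rfl h =>
    subst h
    have h1 : HEq ((GlueDec.rfl rfl : GlueDec P P).val 𝔖) (𝟙 (𝔖.starDiagram.pathFunctor' P)) := by
      rw [val_rfl]; exact eqToHom_heq_id _ rfl
    refine h1.trans ?_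
    cases d₂ with
    | rfl h' => rw [val_rfl]; exact (eqToHom_heq_id _ rfl).symm
    | reroute p q t ht hP hQ => rw [val_reroute]; exact (eqToHom_heq_id _ rfl).symm
    | cell g hg hP hQ =>
      refine HEq.symm ((𝔖.val_cell_heq g hg hP hQ).trans ?_)
      rw [𝔖.cellη_of_eq g (hP.symm.trans hQ) (by rw [← hP, ← hQ])]
      exact eqToHom_heq_id _ (by rw [hP])
    | tailCell p q g hg hP hQ =>
      obtain ⟨-, e⟩ := split_unique p q g.left g.right (hP.symm.trans hQ) hg
        (by rw [← StarCell.refCount_left_eq_right]; exact hg)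
      exact (𝔖.val_tailCell_heq_id p q g hg hP hQ e).symm
  | reroute p q t ht hP hQ =>
    have h1 : HEq ((GlueDec.reroute p q t ht hP hQ).val 𝔖) (𝟙 (𝔖.starDiagram.pathFunctor' P)) := by
      rw [val_reroute]; exact eqToHom_heq_id _ rfl
    refine h1.trans ?_
    cases d₂ with
    | rfl h' => rw [val_rfl]; exact (eqToHom_heq_id _ rfl).symm
    | reroute p' q' t' ht' hP' hQ' => rw [val_reroute]; exact (eqToHom_heq_id _ rfl).symm
    | cell g hg hP' hQ' =>
      exact absurd (hP' ▸ hP ▸ visitsRef_comp_ref p t) hg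
    | tailCell p' q' g hg hP' hQ' =>
      obtain ⟨-, e₁⟩ := split_unique p p' t g.left (hP.symm.trans hP') ht hg
      obtain ⟨-, e₂⟩ := split_unique q q' t g.right (hQ.symm.trans hQ') ht
        (by rw [← StarCell.refCount_left_eq_right]; exact hg)
      exact (𝔖.val_tailCell_heq_id p' q' g hg hP' hQ' (e₁.symm.trans e₂)).symm
  | cell g hg hP hQ =>
    refine (𝔖.val_cell_heq g hg hP hQ).trans ?_
    cases d₂ with
    | rfl h' =>
      rw [𝔖.cellη_of_eq g (hP.symm.trans (h'.trans hQ)) (by rw [← hP, ← hQ, h']), val_rfl]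
      exact eqToHom_heq_eqToHom _ _ (by rw [hP])
    | reroute p' q' t' ht' hP' hQ' =>
      exact absurd (hP ▸ hP' ▸ visitsRef_comp_ref p' t') hg
    | cell g' hg' hP' hQ' =>
      obtain rfl : g = g' := StarCell.ext' (hP.symm.trans hP') (hQ.symm.trans hQ')
      exact (𝔖.val_cell_heq g hg hP' hQ').symm
    | tailCell p' q' g' hg' hP' hQ' =>
      exact absurd (hP ▸ hP' ▸ visitsRef_comp_ref p' g'.left) hg
  | tailCell p q g hg hP hQ =>
    cases d₂ with
    | rfl h' =>
      obtain ⟨-, e⟩ := split_unique p q g.left g.right (hP.symm.trans (h'.trans hQ)) hg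
        (by rw [← StarCell.refCount_left_eq_right]; exact hg)
      rw [val_rfl]
      exact (𝔖.val_tailCell_heq_id p q g hg hP hQ e).trans (eqToHom_heq_id _ rfl).symm
    | reroute p' q' t' ht' hP' hQ' =>
      obtain ⟨-, e₁⟩ := split_unique p' p t' g.left (hP'.symm.trans hP) ht' hg
      obtain ⟨-, e₂⟩ := split_unique q' q t' g.right (hQ'.symm.trans hQ) ht'
        (by rw [← StarCell.refCount_left_eq_right]; exact hg)
      rw [val_reroute]
      exact (𝔖.val_tailCell_heq_id p q g hg hP hQ (e₁.symm.trans e₂)).trans (eqToHom_heq_id _ rfl).symm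
    | cell g' hg' hP' hQ' =>
      exact absurd (hP' ▸ hP ▸ visitsRef_comp_ref p g.left) hg'
    | tailCell p' q' g' hg' hP' hQ' =>
      obtain ⟨rfl, e₁⟩ := split_unique p p' g.left g'.left (hP.symm.trans hP') hg hg'
      obtain ⟨rfl, e₂⟩ := split_unique q q' g.right g'.right (hQ.symm.trans hQ')
        (by rw [← StarCell.refCount_left_eq_right]; exact hg)
        (by rw [← StarCell.refCount_left_eq_right]; exact hg')
      obtain rfl : g = g' := StarCell.ext' e₁ e₂
      rfl

/-! ### The homotopy of a glued pair -/

/-- **The homotopy of a glued pair** `(P, Q) ∈ GlueE` between the structural path functors: `K₀`'s over `𝔈`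
(abc-iut-L4-t5's `coresFamily`, whose boundary set is all pairs into `𝔈`) if the pair ends at `𝔈`, else the
homotopy of any presentation. [cite: MochizukiAbsTopIII2015, Cor 3.7 (iii) p.88] -/
noncomputable def glueLogη {a b : Cor37Vertex} {P Q : StarPath.{u} a b} (h : GlueE P Q) :
    𝔖.starDiagram.pathFunctor' P ⟶ 𝔖.starDiagram.pathFunctor' Q :=
  if hb : b = Cor37Vertex.galois then
    eqToHom (pathFunctor_eq_pathFunctor' _ P).symm ≫ 𝔖.coresFamily.η ((𝔖.coresFamily_E_iff P Q).2 hb) ≫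
      eqToHom (pathFunctor_eq_pathFunctor' _ Q)
  else (Classical.choice (nonempty_glueDec h hb)).val 𝔖

/-- On pairs into `𝔈`, `glueLogη` is `K₀`'s homotopy (re-typed to the structural path functors).
[cite: MochizukiAbsTopIII2015, Cor 3.7 (iii) p.88] -/
theorem glueLogη_of_galois {a : Cor37Vertex} {P Q : StarPath.{u} a Cor37Vertex.galois} (h : GlueE P Q)
    (hK : 𝔖.coresFamily.E P Q) :
    𝔖.glueLogη h = eqToHom (pathFunctor_eq_pathFunctor' _ P).symm ≫ 𝔖.coresFamily.η hK ≫
      eqToHom (pathFunctor_eq_pathFunctor' _ Q) := by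
  rw [glueLogη, dif_pos rfl]

/-- On pairs into `𝔈`, `glueLogη` is heterogeneously `K₀`'s homotopy. [cite: MochizukiAbsTopIII2015, Cor 3.7 (iii) p.88] -/
theorem glueLogη_heq_of_galois {a : Cor37Vertex} {P Q : StarPath.{u} a Cor37Vertex.galois} (h : GlueE P Q)
    (hK : 𝔖.coresFamily.E P Q) : HEq (𝔖.glueLogη h) (𝔖.coresFamily.η hK) := by
  rw [𝔖.glueLogη_of_galois h hK]
  exact HomotopyFamily.heq_eqToHom_comp_comp_eqToHom _ _ _

/-- Off `𝔈`, `glueLogη` is the homotopy of ANY presentation. [cite: MochizukiAbsTopIII2015, Cor 3.7 (iii) p.88] -/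
theorem glueLogη_eq_val {a b : Cor37Vertex} {P Q : StarPath.{u} a b} (h : GlueE P Q)
    (hb : b ≠ Cor37Vertex.galois) (d : GlueDec P Q) : 𝔖.glueLogη h = d.val 𝔖 := by
  rw [glueLogη, dif_neg hb]
  exact 𝔖.val_heq _ d

end BiAnabelianSetting

end Literature.AnabelianGeometry.AbsoluteAnabelian.AbsTopIII
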